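import Mathlib
import Summits.NavierStokesRegularity.NavierStokesRegularity.Theorems.WakeRatchetTailRatchetQuietPastAction
import HarnessLib

/-!
# `WakeRatchet.TailRatchet` (stmt-NavierStokesRegularity-21808) — hypothesis class of the tail ratchets, INVISCID slice:
# the ancient α-limit of a bounded admissible inviscid eternal solution is again INVISCID (parameter `ν∞ = 0`)

Support file (route `WakeRatchet`; MODEL lattice ODEs of Tao 2016 §4 / §6.4 — nothing here concerns the Navier–Stokes
equations; no item is closed).  Eleventh file of the `WakeRatchetQuietPast` series: the `ν̂ = 0` reading of
`exists_alpha_limit_action` for the hypothesis class of the registered stub `stub_inviscid` of the line `birth` and of the live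
slice stmt-25646 (`EternalInviscidRate`): all frame parameters vanish, so the limit parameter is `0` and the limit solves the
INVISCID renormalised lattice (the `law` clause of `IsEternal ε₀ α W∞`), with the uniform bound, the action clause and
non-triviality `‖W∞_0(0)‖ ≥ 1/(64K)` (`exists_alpha_limit_inviscid`).  Only the forward clause `bdd` is not claimed.

HONEST FRAMING: no stub, crux, rung or summit is proved (stmt-21808 stays dead modulo `WakeRatchetDyadicFront.DyadicScalarFronts`).
-/

noncomputable section

set_option linter.dupNamespace false

namespace Summit.NavierStokesRegularity.NavierStokesRegularity.Theorems

namespace WakeRatchetQuietPast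

open Set Filter Topology MeasureTheory
open Literature.Analysis.FluidPDE Literature.Analysis.FluidPDE.TaoCascade
open Summit.NavierStokesRegularity.NavierStokesRegularity.Cruxes.MinimalBlowupExtraction.ClockedFrames (vfield)

variable {ε₀ : ℝ} {α : Fin 4 → Fin 4 → Fin 4 → ℤ × ℤ × ℤ → ℝ} {W : ℤ → ℝ → Em 4}

/-- The field with parameter `0` is the inviscid right-hand side of `IsEternal.law`.
[cite: Tao2016AveragedNS, §4 Lemma 4.1 (4.8); cell lemma] -/
theorem vfield_zero (V : ℤ → ℝ → Em 4) (n : ℤ) (u : ℝ) :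
    vfield ε₀ α 0 V n u = -((1 : ℝ) • V n u) + tableQ α (V n u) + bigLam ε₀ • tableA α (V (n - 1) u)
      + (bigLam ε₀)⁻¹ • tableB α (V (n + 1) u) (V n u) := by
  unfold vfield
  rw [zero_mul, zero_smul, sub_zero]

/-- **Inviscid ancient α-limit.**  A non-trivial uniformly bounded (`‖W_j‖ ≤ C`) admissible INVISCID eternal solution
(`IsEternal ε₀ α W`, m = 4, any table; `K > 0` a bound of the table constant) has an ancient α-limit `W∞` of loud far-past
frames which solves the INVISCID renormalised lattice (the `law` clause of `IsEternal ε₀ α W∞`), is bounded by `C`, has integrable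
shells with total action `≤ M`, and `‖W∞_0(0)‖ ≥ 1/(64K)`.
[cite: Tao2016AveragedNS, §4 Lemma 4.1 (4.8)–(4.10), §6.4; cell theorem] -/
theorem exists_alpha_limit_inviscid (hε : -1 < ε₀) (hW : IsEternal ε₀ α W) {K C : ℝ}
    (hK : shiftConst α (0, 0, 0) + bigLam ε₀ * shiftConst α (0, 0, 1)
      + (bigLam ε₀)⁻¹ * (shiftConst α (1, 0, 0) + shiftConst α (0, 1, 0)) ≤ K)
    (hK0 : 0 < K) (hC0 : 0 ≤ C) (hC : ∀ (j : ℤ) (σ : ℝ), ‖W j σ‖ ≤ C) (hne : ∃ (n : ℤ) (σ : ℝ), W n σ ≠ 0) :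
    ∃ Winf : ℤ → ℝ → Em 4,
      (∀ (n : ℤ) (σ : ℝ), HasDerivAt (Winf n)
        (-((1 : ℝ) • Winf n σ) + tableQ α (Winf n σ) + bigLam ε₀ • tableA α (Winf (n - 1) σ)
          + (bigLam ε₀)⁻¹ • tableB α (Winf (n + 1) σ) (Winf n σ)) σ) ∧
      (∀ (n : ℤ) (σ : ℝ), ‖Winf n σ‖ ≤ C) ∧
      (∃ M : ℝ, ∀ n : ℤ, Integrable (fun σ => ‖Winf n σ‖) ∧ ∫ σ, ‖Winf n σ‖ ≤ M) ∧
      1 / (64 * K) ≤ ‖Winf 0 0‖ := by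
  have hW' : IsEternalVisc ε₀ 0 α W := hW.isEternalVisc
  obtain ⟨k, s, φ, νinf, Winf, -, -, -, hνlim, hconv, hlaw, hWb, hW0⟩ :=
    exists_alpha_limit hε hW' hK hK0 hC0 hC hne
  -- all frame parameters vanish, so `ν∞ = 0`
  have hzero : (fun j => (0 : ℝ) * ((1 + ε₀) ^ ((2 : ℝ) * (k (φ j))) * Real.exp (-(s (φ j))))) = fun _ => 0 := by
    funext j; rw [zero_mul]
  rw [hzero] at hνlim
  have hν0 : νinf = 0 := tendsto_nhds_unique hνlim tendsto_const_nhds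
  have hcont : ∀ n : ℤ, Continuous (Winf n) :=
    fun n => continuous_iff_continuousAt.2 fun σ => (hlaw n σ).continuousAt
  have hpt : ∀ (n : ℤ) (σ : ℝ), Tendsto (fun j => W (n + k (φ j)) (σ + s (φ j))) atTop (𝓝 (Winf n σ)) :=
    fun n σ => hconv n (fun _ => σ) σ tendsto_const_nhds
  refine ⟨Winf, fun n σ => ?_, hWb, limit_action hW' hC hpt hcont, hW0⟩
  have h := hlaw n σ
  rw [hν0, vfield_zero] at h
  exact h

end WakeRatchetQuietPast

end Summit.NavierStokesRegularity.NavierStokesRegularity.Theorems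

end
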